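/-
Origin: expansion seat `planner-pub-hodgecm-mc-axioms-1-g14-0`, handover #W144 2026-08-20T15:53:55Z md5 726f5f813194 (PKG 8466f9c25f8e → 726f5f813194; 642 l.; MECHANICAL (iib-R) rewrite v3.1 of the PKG file as it stands (33 token edits; rules R1x1+RX[h₂']x32)) (`HOME/mc/pub-hodgecm-mc-axioms-1-g14/revendor/kit-r55/stage55/HodgeCM/Model/ArchKTypeOfLine.lean`, md5 726f5f813194, 642 lines);
landed by the gen-22 packager (p-g22) in gate run 55 REPLACES the earlier landed copy of `HodgeCM/Model/ArchKTypeOfLine.lean` (seat copy carried the packager Origin header of an earlier run (stripped)).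
-/
/-
Copyright (c) 2026. Released under Apache 2.0 license as described in the file LICENSE.
Cell pub-hodgecm, MODEL layer (construction prover mc-carch-1, gen 2), BINDER-OWNERS rows 12/14/15 (`C` / `hpd` / `hk`):
the ASSEMBLED honest-pin term of row 12 for E's lines `k = 0, 1` AT period-1's S term `archSideOf V c …`, with every junction
of #CA1v4 filled by its discharger of record (#CA3/#CA9 `hA`, #CA5 `hfix`, #CA11 `harm`, #1097 `hK`, (Θ-sat) `hsat`), and E's
row 14 `hpd` PROVED for it along `BallForms.expP` modulo the slot's small datum.
-/
import Summits.HodgeConjecture.HodgeCM.Model.ArchKTypeOfHarm_2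
import Summits.HodgeConjecture.HodgeCM.Model.ArchKTypeOfFix
import Summits.HodgeConjecture.HodgeCM.Model.ArchKTypeOfTwist
import Summits.HodgeConjecture.HodgeCM.Model.ArchSideOf_2
import Summits.HodgeConjecture.HodgeCM.Model.HypCensus.SmoothBlockSlot

/-!
# Row 12 assembled at the honest S term: `archKTypeOfLineZero/One`, and row 14 for it

For the S pin term of record `S₀ := archSideOf V c hGR hGR₀ hGR₁ hGR₂ hGR₃ η hη hηc h₁W A` (period-1 `Model/ArchSideOf`, #1099;
sinst-1's total family `SInstance.S` equals it at every good context, `S_eq_archSideOf_of_goodCtx`, and `ArchKTypeData.castSide`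
transports E's `C` along that equality) this file BUILDS, for E's two lines `k = 0, 1`,

  `archKTypeOfLineZero … : ArchKTypeData (thetaSpaceInputIn hHD hI h₁ h₃ S₀ hV) 0 N`   (and `…One` for `k = 1`)

as `archKTypeOf` (#CA1v4) with: level `Γ₀`, finite `K`-type `satLevelRegimeOf V hV Γ₀.K` (`hK` = #CA1 `satLevelRegimeOf_le_archFinOf`,
`hsat` = `id` by `thetaSpaceInputIn_KΓ`), `ωA := lineOmega_k` with `hA` = #CA9 `lineRepOf_k_archInfOf_eq` (the pin's `(P k).ω`/`ιinf`
ARE `lineRepOf k`/`archInfOf V`, `rfl`), `Φarch := blockFamilyOf … (blockPosEquiv V) (blockNegEquiv V) Φ₁ Φ₂` (#CA4v3), `hfix` = #CA5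
`satLevel_fix_of_arch_of_fin harch hfin`, `harm` = #CA11 `lineOmega_k_harm hsec hK hΦ₁ hχ`.  The REMAINING HYPOTHESES are exactly
the primitive junctions of the row-12 ledger, each in its owner's currency:

* `hlevel` (L3, theta-3) · `arch₀ : blockFamilyOf … Φ₁ Φ₂ ℓ₀ = (A k).Φinf` (theta-3's (E1) datum; `rfl` at `ArchLineDatumOf`) ·
  `harch` ((c5), discharge-4) · `hfin` ((D-2), discharge-2) · `hsec` ((J-x₀)⇄(J-arch) on `Stab(x₀)`, route (a) of (TWIST-2)) ·
  `hK` (binder-2's vacuum character `ev` at `v₁`, `exists_vacExponents_cmBlockRep_κ_tensorPi`) · `hΦ₁` (std `μ₀`-type of `Φ₁`) ·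
  `hχ` (the scalar identity of the line scalar on `K_∞`).

Then (§ 3) **`isWeaklyPDiff_archKTypeOfLineZero/One`** — E's row 14 `hpd : C.IsWeaklyPDiff BallForms.expP` for these terms — is PROVED
modulo ONE existence statement `hslot : ∃ ω₁, IsArchWeilDatum (ι𝕎 (Fin 2) Unit R S) ω₁ ∧ ∀ u, Continuous (ω₁ u)` (the slot's
small datum, binder-2's `hslot` currency; theta-1's linearised datum + swap at a positive line): the four sign facts are
DISCHARGED here (`frameD_sign_ι₁'`, the plane sign `h₁W` of `archSideOf` itself, `frameD_sign_of_ne`, and the vacuous line fact),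
BRICK 4 (#CA4v3 `isWeaklyPDiff_archKTypeOf_blockPair`) runs along the chart `twistU21 ∘ expP` with `hωA` = #CA9
`lineOmega_k_twistU21_expP`, and #CA10 `isWeaklyPDiff_twistVec_iff` moves it to `expP` — BRANCH-FREE.  Row 15 (§ 4) is recorded
along the twisted chart: **`isPMinusKilledAlong_archKTypeOfLineZero/One_twist`** (modulo `hslot` and the harmonicity `hf` of `Φ₁`);
its passage to `expP` is the (TWIST-2) item.

Nothing is cited and nothing is minted: two terms of an existing structure and kernel lemmas; 0 records, 0 `def … : Prop`.
-/

set_option autoImplicit false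

noncomputable section

open Filter Topology Complex
open NumberField NumberField.InfinitePlace NumberField.mixedEmbedding IsDedekindDomain MeasureTheory
open scoped Matrix TensorProduct Classical SchwartzMap
open MulAction
open Literature.Geometry.ComplexHyperbolic.BallModel (U21 x₀ stabilizerEquivK21)
open Literature.NumberTheory.Automorphic.U21 (K21 matA sclD)
open Literature.AlgebraicGeometry.HodgeTheory
open Literature.AlgebraicGeometry.ShimuraVarieties Literature.AlgebraicGeometry.ShimuraVarieties.BallForms
open Literature.NumberTheory.Automorphic Literature.NumberTheory.Weil1964
open Literature.RepresentationTheory.KonnoKonno2007 Literature.RepresentationTheory.KonnoKonno2007.RealDualPair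
open Literature.NumberTheory.GelbartRogawski1991 Literature.NumberTheory.GelbartRogawski1991.UnitaryDualPair
open Literature.Analysis.SegalBargmann
open Literature.NumberTheory.Automorphic.PicardCM
open HodgeCM.Adelic HodgeCM.PerL34 HodgeCM.Model.HypCensus HodgeCM.Model.SupplyInstance HodgeCM.Model.ArchSideTerm

namespace HodgeCM.Model

/-! ## § 1 The sign facts of a LINE at the pin (all four discharged) -/

section LineSigns

variable {L : CMField} {ι₁ : L →+* ℂ} (V : HermSpace3 L ι₁) {d : Fin 2 → (L : Type)}

/-- `hs₁W` for the line `⟨d i⟩` from the plane sign at `ι₁`. -/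
theorem line_hs₁W (h₁W : (∀ j, 0 < (ι₁ (d j)).re) ∨ ∀ j, (ι₁ (d j)).re < 0) (i : Fin 2) :
    (∀ j : Fin 1, 0 < (ι₁ (lineVec (L : Type) (d i) j)).re) ∨ ∀ j : Fin 1, (ι₁ (lineVec (L : Type) (d i) j)).re < 0 :=
  h₁W.imp (fun h _ => h i) (fun h _ => h i)

/-- `hsW` for a line is vacuous (`j₀ := 0`, `Fin 1` has one element). -/
theorem line_hsW (x : L) (τ : L →+* ℂ) (_hτ : InfinitePlace.mk τ ≠ InfinitePlace.mk ι₁) :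
    (∃ j₀ : Fin 1, ∀ j, j ≠ j₀ → 0 < (τ (lineVec (L : Type) x j)).re) ∨ ∀ j, (τ (lineVec (L : Type) x j)).re < 0 :=
  Or.inl ⟨0, fun j hj => absurd (Subsingleton.elim j 0) hj⟩

end LineSigns

/-! ## § 1b The small datum of a POSITIVE line slot `U(2,1) × U(R,∅)` (theta-1's linearised datum, no swap) -/

section LineSlot

variable {R S : Type} [Fintype R] [DecidableEq R] [Fintype S] [DecidableEq S]

/-- **The slot's small datum EXISTS when the line is positive at `v₁`** (`R` nonempty, `S` empty): theta-1's linearised datum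
`linWeil` of `U(Fin 2, Unit) × U(R, ∅)` (tree `isArchWeilDatum_linWeil_neg_card`, vacuum exponents `(0, −|R|, 0, 0)`), whose operators
are scalar multiples of the continuous vacuum section. -/
theorem exists_isArchWeilDatum_lineSlot [Nonempty R] [IsEmpty S] :
    ∃ ω₁ : Representation ℂ (Ginf (Fin 2) Unit R S) (SchwartzMap (DPIdx (Fin 2) Unit R S → ℝ) ℂ),
      IsArchWeilDatum (ι𝕎 (Fin 2) Unit R S) ω₁ ∧ ∀ u, Continuous (ω₁ u) := by
  obtain ⟨ω, hω, -, hlin⟩ := isArchWeilDatum_linWeil_neg_card (P := Fin 2) (Q := Unit) (R := R) (S := S) 0 ()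
  refine ⟨ω, hω, fun g => ?_⟩
  have h1 : ∀ f, ω g f = linPhase R S () (-((Fintype.card R : ℕ) : ℤ)) g •
      vacSection (fun g : Ginf (Fin 2) Unit R S => (⇑((ι𝕎 (Fin 2) Unit R S g).1 :
        ((DPIdx (Fin 2) Unit R S → ℝ) × (DPIdx (Fin 2) Unit R S → ℝ)) ≃ₗ[ℝ] (DPIdx (Fin 2) Unit R S → ℝ) × (DPIdx (Fin 2) Unit R S → ℝ)) :
          PhaseMap (DPIdx (Fin 2) Unit R S))) g f := fun f => by
    rw [hlin g, linWeil_apply]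
  exact ((vacSection _ g).continuous.const_smul _).congr fun f => by simpa only [Pi.smul_apply] using (h1 f).symm

end LineSlot

/-! ## § 2 The assembled terms for lines 0 and 1 -/

section Line

variable (hHD : exists_isReal_hodgeModel) (hI : hodgePQ_independent_of_hodgeModel)
  (h₁ : BallQuotientUniformised)  (h₃ : CMAbelianVarietyRealised)

variable {L : CMField} {ι₁ : L →+* ℂ} (V : HermSpace3 L ι₁) (c : SeesawCtx L)
  (hGR : (cmSplittingDatum (L : Type) finProdFinEquiv (frameD V) (frameD_real V) (frameD_ne V) (dW c.D) (dW_real c.D)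
    (dW_ne c.D)).CompatibleSplitting)
  (hGR₀ : (cmSplittingDatum (L : Type) (e₁) (frameD V) (frameD_real V) (frameD_ne V) (lineVec (L : Type) (dW c.D 0))
    (fun _ => dW_real c.D 0) (fun _ => dW_ne c.D 0)).CompatibleSplitting)
  (hGR₁ : (cmSplittingDatum (L : Type) (e₁) (frameD V) (frameD_real V) (frameD_ne V) (lineVec (L : Type) (dW c.D 1))
    (fun _ => dW_real c.D 1) (fun _ => dW_ne c.D 1)).CompatibleSplitting)
  (hGR₂ : (cmSplittingDatum (L : Type) (e₁) (frameD V) (frameD_real V) (frameD_ne V) (lineVec (L : Type) (dW' c.D 0))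
    (fun _ => dW'_real c.D 0) (fun _ => dW'_ne c.D 0)).CompatibleSplitting)
  (hGR₃ : (cmSplittingDatum (L : Type) (e₁) (frameD V) (frameD_real V) (frameD_ne V) (lineVec (L : Type) (dW' c.D 1))
    (fun _ => dW'_real c.D 1) (fun _ => dW'_ne c.D 1)).CompatibleSplitting)
  (η : CMAdelic (L : Type) (frameD V) × CMAdelic (L : Type) (dW c.D) →* ℂˣ)
  (hη : ∀ γU ∈ CMRat (L : Type) (frameD V), ∀ γ ∈ CMRat (L : Type) (dW c.D), η (γU, γ) = 1)
  (hηc : Continuous fun p => ((η p : ℂˣ) : ℂ))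
  (h₁W : (∀ j, 0 < (ι₁ (dW c.D j)).re) ∨ ∀ j, (ι₁ (dW c.D j)).re < 0)
  (A : ∀ k : Fin 4, ArchLineInput V (lineRepD V c.D hGR hGR₀ hGR₁ hGR₂ hGR₃ η k))
  (hV : IsAnisotropic L V.Hm) (N : ℕ) (Γ₀ : Level V)

/-! ### line 0 -/

section Zero

variable
  (hlevel : ∀ δ ∈ levelImage hHD hI h₁ h₃ Γ₀ hV, ∃ x : (V.latticeModel printFact_unitaryCompact_holds).G,
    x ∈ (satLevelRegimeOf V hV Γ₀.K : Subgroup (V.latticeModel printFact_unitaryCompact_holds).G) ∧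
      (archSideOf V c hGR hGR₀ hGR₁ hGR₂ hGR₃ η hη hηc h₁W A).ιinf δ * x ∈ (V.latticeModel printFact_unitaryCompact_holds).Γ)
  (Φ₁ : Module.Dual ℂ (Fin 2 → ℂ) →ₗ[ℂ]
    SchwartzMap (DPIdx (Fin 2) Unit
      (PosIdx (cmXW (L : Type) (frameD V) (lineVec (L : Type) (dW c.D 0)) (fun _ => dW_real c.D 0) ι₁ (cmPlace (L : Type) ι₁)))
      (NegIdx (cmXW (L : Type) (frameD V) (lineVec (L : Type) (dW c.D 0)) (fun _ => dW_real c.D 0) ι₁ (cmPlace (L : Type) ι₁))) → ℝ) ℂ)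
  (Φ₂ : SchwartzMap ((Fin 3 × {v : {v : InfinitePlace ↥(maximalRealSubfield L) // v.IsReal} // v ≠ cmPlace (L : Type) ι₁}) → ℝ) ℂ)
  (ℓ₀ : Module.Dual ℂ (Fin 2 → ℂ))
  (arch₀ : blockFamilyOf (L : Type) e₁ (frameD V) (frameD_real V) (frameD_ne V) (lineVec (L : Type) (dW c.D 0))
      (fun _ => dW_real c.D 0) (fun _ => dW_ne c.D 0) ι₁ (blockPosEquiv V) (blockNegEquiv V) Φ₁ Φ₂ ℓ₀ = (A 0).Φinf)
  (harch : ∀ a : UnitaryGroup.arch (↥(maximalRealSubfield L)) L (IsCMField.complexConj L) 3 V.Hm,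
    UnitaryGroup.archAt (↥(maximalRealSubfield L)) L (IsCMField.complexConj L) 3 V.Hm (UnitaryGroup.cmPlace (L : Type) ι₁)
        (NumberField.complexConj_smul_infinitePlace (L : Type) _) (IsCMField.complexConj_ne_one (L : Type)) a = 1 →
    ∀ ℓ, ((archSideOf V c hGR hGR₀ hGR₁ hGR₂ hGR₃ η hη hηc h₁W A).P 0).ω
        (HodgeCM.Adelic.regimeEquiv L V.Hm hV
          (UnitaryGroup.archToAdelic (↥(maximalRealSubfield L)) L (IsCMField.complexConj L) 3 V.Hm a), 1)
        (testFun (↥(maximalRealSubfield L)) (Fin 3)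
          (blockFamilyOf (L : Type) e₁ (frameD V) (frameD_real V) (frameD_ne V) (lineVec (L : Type) (dW c.D 0))
            (fun _ => dW_real c.D 0) (fun _ => dW_ne c.D 0) ι₁ (blockPosEquiv V) (blockNegEquiv V) Φ₁ Φ₂ ℓ) (A 0).x₀ N) =
      testFun (↥(maximalRealSubfield L)) (Fin 3)
        (blockFamilyOf (L : Type) e₁ (frameD V) (frameD_real V) (frameD_ne V) (lineVec (L : Type) (dW c.D 0))
          (fun _ => dW_real c.D 0) (fun _ => dW_ne c.D 0) ι₁ (blockPosEquiv V) (blockNegEquiv V) Φ₁ Φ₂ ℓ) (A 0).x₀ N)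
  (hfin : ∀ kf : UnitaryGroup.finAdelic (↥(maximalRealSubfield L)) L (IsCMField.complexConj L) 3 V.Hm, kf ∈ Γ₀.K →
    ∀ Φinf : 𝓢((Fin 3 → mixedSpace (↥(maximalRealSubfield L))), ℂ),
      ((archSideOf V c hGR hGR₀ hGR₁ hGR₂ hGR₃ η hη hηc h₁W A).P 0).ω
          (HodgeCM.Adelic.regimeEquiv L V.Hm hV
            (UnitaryGroup.finAdelicToAdelic (↥(maximalRealSubfield L)) L (IsCMField.complexConj L) 3 V.Hm kf), 1)
          (testFun (↥(maximalRealSubfield L)) (Fin 3) Φinf (A 0).x₀ N) =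
        testFun (↥(maximalRealSubfield L)) (Fin 3) Φinf (A 0).x₀ N)
  (hsec : ∀ u : stabilizer U21 x₀,
    cmBlockSection (L : Type) (frameD V) (frameD_real V) (frameD_ne V) (lineVec (L : Type) (dW c.D 0)) (fun _ => dW_real c.D 0)
        (fun _ => dW_ne c.D 0) ι₁ (blockPosEquiv V) (blockNegEquiv V) (u21FrameEquiv (u : U21), 1) = (archSectionFrameOf V u, 1))
  {ev : VacExponents}
  (hK : ∀ (kk : DPK (Fin 2) Unit
      (PosIdx (cmXW (L : Type) (frameD V) (lineVec (L : Type) (dW c.D 0)) (fun _ => dW_real c.D 0) ι₁ (cmPlace (L : Type) ι₁)))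
      (NegIdx (cmXW (L : Type) (frameD V) (lineVec (L : Type) (dW c.D 0)) (fun _ => dW_real c.D 0) ι₁ (cmPlace (L : Type) ι₁))))
    (Φ : SchwartzMap (DPIdx (Fin 2) Unit
      (PosIdx (cmXW (L : Type) (frameD V) (lineVec (L : Type) (dW c.D 0)) (fun _ => dW_real c.D 0) ι₁ (cmPlace (L : Type) ι₁)))
      (NegIdx (cmXW (L : Type) (frameD V) (lineVec (L : Type) (dW c.D 0)) (fun _ => dW_real c.D 0) ι₁ (cmPlace (L : Type) ι₁))) → ℝ) ℂ),
    cmBlockRep (L : Type) e₁ (frameD V) (frameD_real V) (frameD_ne V) (lineVec (L : Type) (dW c.D 0)) (fun _ => dW_real c.D 0)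
        (fun _ => dW_ne c.D 0) hGR₀ ι₁ (blockPosEquiv V) (blockNegEquiv V)
        (cmBlockSection (L : Type) (frameD V) (frameD_real V) (frameD_ne V) (lineVec (L : Type) (dW c.D 0)) (fun _ => dW_real c.D 0)
          (fun _ => dW_ne c.D 0) ι₁ (blockPosEquiv V) (blockNegEquiv V) (κ _ _ _ _ kk)) (tensorPi Φ Φ₂) =
      tensorPi (κOp _ _ ev kk Φ) Φ₂)
  (hΦ₁ : ∀ (kV : Matrix.unitaryGroup (Fin 2) ℂ × Matrix.unitaryGroup Unit ℂ) (b : Fin 2 → ℂ),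
    unitaryOpPi (dualPairι ((kV, 1) : DPK (Fin 2) Unit
        (PosIdx (cmXW (L : Type) (frameD V) (lineVec (L : Type) (dW c.D 0)) (fun _ => dW_real c.D 0) ι₁ (cmPlace (L : Type) ι₁)))
        (NegIdx (cmXW (L : Type) (frameD V) (lineVec (L : Type) (dW c.D 0)) (fun _ => dW_real c.D 0) ι₁ (cmPlace (L : Type) ι₁)))))
        (Φ₁ (dotProductEquiv ℂ (Fin 2) b)) =
      Φ₁ (dotProductEquiv ℂ (Fin 2) ((kV.1 : Matrix (Fin 2) (Fin 2) ℂ) *ᵥ b)))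
  (hχ : ∀ u : stabilizer U21 x₀,
    ((lineScalar_zero V c.D hGR hGR₀ hGR₁ (eta₀ V c.D η) (u : U21) : ℂˣ) : ℂ) *
        ((matA (stabilizerEquivK21.symm u)).det ^ ev.eP * sclD (stabilizerEquivK21.symm u) ^ ev.eQ) =
      star (sclD (stabilizerEquivK21.symm u)))

/-- **ROW 12 FOR LINE 0, ASSEMBLED AT THE HONEST S TERM.** -/
def archKTypeOfLineZero :
    ArchKTypeData (thetaSpaceInputIn hHD hI h₁ h₃ (archSideOf V c hGR hGR₀ hGR₁ hGR₂ hGR₃ η hη hηc h₁W A) hV) 0 N :=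
  archKTypeOf hHD hI h₁ h₃ (archSideOf V c hGR hGR₀ hGR₁ hGR₂ hGR₃ η hη hηc h₁W A) hV 0 N Γ₀ Γ₀.K
    (satLevelRegimeOf_le_archFinOf V hV Γ₀.K) hlevel (fun _ hg => hg)
    (lineOmega_zero V c.D hGR hGR₀ hGR₁ (eta₀ V c.D η))
    (fun g => lineRepOf_zero_archInfOf_eq V c.D hGR hGR₀ hGR₁ hGR₂ hGR₃ (eta₀ V c.D η) (eta₁ V c.D η) (eta₂ V c.D η)
      (eta₃ V c.D η) hV g)
    (blockFamilyOf (L : Type) e₁ (frameD V) (frameD_real V) (frameD_ne V) (lineVec (L : Type) (dW c.D 0)) (fun _ => dW_real c.D 0)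
      (fun _ => dW_ne c.D 0) ι₁ (blockPosEquiv V) (blockNegEquiv V) Φ₁ Φ₂)
    ℓ₀ arch₀
    (satLevel_fix_of_arch_of_fin (archSideOf V c hGR hGR₀ hGR₁ hGR₂ hGR₃ η hη hηc h₁W A) hV 0 N Γ₀.K
      (fun ℓ => blockFamilyOf (L : Type) e₁ (frameD V) (frameD_real V) (frameD_ne V) (lineVec (L : Type) (dW c.D 0))
        (fun _ => dW_real c.D 0) (fun _ => dW_ne c.D 0) ι₁ (blockPosEquiv V) (blockNegEquiv V) Φ₁ Φ₂ ℓ) harch hfin)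
    (lineOmega_zero_harm V c.D hGR hGR₀ hGR₁ (eta₀ V c.D η) Φ₁ Φ₂ hsec hK hΦ₁ hχ)

/-- unfolding (`rfl`). -/
theorem archKTypeOfLineZero_def :
    archKTypeOfLineZero hHD hI h₁ h₃ V c hGR hGR₀ hGR₁ hGR₂ hGR₃ η hη hηc h₁W A hV N Γ₀ hlevel Φ₁ Φ₂ ℓ₀ arch₀ harch hfin hsec
        hK hΦ₁ hχ =
      archKTypeOf hHD hI h₁ h₃ (archSideOf V c hGR hGR₀ hGR₁ hGR₂ hGR₃ η hη hηc h₁W A) hV 0 N Γ₀ Γ₀.K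
        (satLevelRegimeOf_le_archFinOf V hV Γ₀.K) hlevel (fun _ hg => hg)
        (lineOmega_zero V c.D hGR hGR₀ hGR₁ (eta₀ V c.D η))
        (fun g => lineRepOf_zero_archInfOf_eq V c.D hGR hGR₀ hGR₁ hGR₂ hGR₃ (eta₀ V c.D η) (eta₁ V c.D η) (eta₂ V c.D η)
          (eta₃ V c.D η) hV g)
        (blockFamilyOf (L : Type) e₁ (frameD V) (frameD_real V) (frameD_ne V) (lineVec (L : Type) (dW c.D 0)) (fun _ => dW_real c.D 0)
          (fun _ => dW_ne c.D 0) ι₁ (blockPosEquiv V) (blockNegEquiv V) Φ₁ Φ₂)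
        ℓ₀ arch₀
        (satLevel_fix_of_arch_of_fin (archSideOf V c hGR hGR₀ hGR₁ hGR₂ hGR₃ η hη hηc h₁W A) hV 0 N Γ₀.K
          (fun ℓ => blockFamilyOf (L : Type) e₁ (frameD V) (frameD_real V) (frameD_ne V) (lineVec (L : Type) (dW c.D 0))
            (fun _ => dW_real c.D 0) (fun _ => dW_ne c.D 0) ι₁ (blockPosEquiv V) (blockNegEquiv V) Φ₁ Φ₂ ℓ) harch hfin)
        (lineOmega_zero_harm V c.D hGR hGR₀ hGR₁ (eta₀ V c.D η) Φ₁ Φ₂ hsec hK hΦ₁ hχ) :=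
  rfl

set_option backward.isDefEq.respectTransparency false in
/-- **ROW 14 (`hpd`) FOR LINE 0 AT THE HONEST S TERM, along E's chart `BallForms.expP`** — modulo ONE existence statement, the
slot's small archimedean Weil datum (`hslot`, binder-2's currency).  The four sign facts are discharged (`frameD_sign_ι₁'`, the
plane sign `h₁W`, `frameD_sign_of_ne`, `line_hsW`); BRICK 4 runs along `twistU21 ∘ expP` (#CA4v3 + #CA9 `hωA`) and #CA10 moves the
conclusion to `expP` (branch-free). -/
theorem isWeaklyPDiff_archKTypeOfLineZero
    (hslot : ∃ ω₁ : Representation ℂ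
        (Ginf (Fin 2) Unit
          (PosIdx (cmXW (L : Type) (frameD V) (lineVec (L : Type) (dW c.D 0)) (fun _ => dW_real c.D 0) ι₁ (cmPlace (L : Type) ι₁)))
          (NegIdx (cmXW (L : Type) (frameD V) (lineVec (L : Type) (dW c.D 0)) (fun _ => dW_real c.D 0) ι₁ (cmPlace (L : Type) ι₁))))
        (SchwartzMap (DPIdx (Fin 2) Unit
          (PosIdx (cmXW (L : Type) (frameD V) (lineVec (L : Type) (dW c.D 0)) (fun _ => dW_real c.D 0) ι₁ (cmPlace (L : Type) ι₁)))
          (NegIdx (cmXW (L : Type) (frameD V) (lineVec (L : Type) (dW c.D 0)) (fun _ => dW_real c.D 0) ι₁ (cmPlace (L : Type) ι₁))) → ℝ)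
          ℂ),
      IsArchWeilDatum (ι𝕎 (Fin 2) Unit _ _) ω₁ ∧ ∀ u, Continuous (ω₁ u)) :
    (archKTypeOfLineZero hHD hI h₁ h₃ V c hGR hGR₀ hGR₁ hGR₂ hGR₃ η hη hηc h₁W A hV N Γ₀ hlevel Φ₁ Φ₂ ℓ₀ arch₀ harch hfin hsec
        hK hΦ₁ hχ).IsWeaklyPDiff BallForms.expP := by
  obtain ⟨ω₁, hW₁, hc₁⟩ := hslot
  obtain ⟨ev₁, hvac₁⟩ := (junction (Fin 2) Unit _ _).exists_vacExponents hW₁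
  refine (ArchKTypeData.isWeaklyPDiff_twistVec_iff
    (X := thetaSpaceInputIn hHD hI h₁ h₃ (archSideOf V c hGR hGR₀ hGR₁ hGR₂ hGR₃ η hη hηc h₁W A) hV) _ BallForms.expP).1 ?_
  rw [← twistU21_comp_expP, archKTypeOfLineZero_def]
  exact isWeaklyPDiff_archKTypeOf_blockPair hHD hI h₁ h₃ _ hV 0 N Γ₀ Γ₀.K _ hlevel _ _ _ e₁ (frameD V) (frameD_real V)
    (frameD_ne V) (lineVec (L : Type) (dW c.D 0)) (fun _ => dW_real c.D 0) (fun _ => dW_ne c.D 0) hGR₀ (blockPosEquiv V)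
    (blockNegEquiv V) Φ₁ Φ₂ ℓ₀ arch₀ _ _ (frameD_sign_ι₁' V) (line_hs₁W h₁W 0) (frameD_sign_of_ne V)
    (fun τ hτ => line_hsW (dW c.D 0) τ hτ) hW₁ hc₁ hvac₁ (fun b => twistU21 L ι₁ (BallForms.expP b))
    (lineOmega_zero_twistU21_expP V c.D hGR hGR₀ hGR₁ (eta₀ V c.D η))

set_option backward.isDefEq.respectTransparency false in
/-- **ROW 14 FOR LINE 0, HYPOTHESIS-FREE AT A POSITIVE LINE**: if line 0 is positive at `v₁` (`NegIdx (x_W(v₁))` empty,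
`PosIdx` nonempty — the sign (χ) forces anyway), `hpd` holds for the assembled term along `BallForms.expP`. -/
theorem isWeaklyPDiff_archKTypeOfLineZero_of_pos
    [Nonempty (PosIdx (cmXW (L : Type) (frameD V) (lineVec (L : Type) (dW c.D 0)) (fun _ => dW_real c.D 0) ι₁ (cmPlace (L : Type) ι₁)))]
    [IsEmpty (NegIdx (cmXW (L : Type) (frameD V) (lineVec (L : Type) (dW c.D 0)) (fun _ => dW_real c.D 0) ι₁ (cmPlace (L : Type) ι₁)))] :
    (archKTypeOfLineZero hHD hI h₁ h₃ V c hGR hGR₀ hGR₁ hGR₂ hGR₃ η hη hηc h₁W A hV N Γ₀ hlevel Φ₁ Φ₂ ℓ₀ arch₀ harch hfin hsec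
        hK hΦ₁ hχ).IsWeaklyPDiff BallForms.expP :=
  isWeaklyPDiff_archKTypeOfLineZero hHD hI h₁ h₃ V c hGR hGR₀ hGR₁ hGR₂ hGR₃ η hη hηc h₁W A hV N Γ₀ hlevel Φ₁ Φ₂ ℓ₀ arch₀ harch
    hfin hsec hK hΦ₁ hχ exists_isArchWeilDatum_lineSlot

set_option backward.isDefEq.respectTransparency false in
/-- **ROW 15 (`hk`) FOR LINE 0 ALONG THE TWISTED CHART `twistU21 ∘ expP`** (END-STATE shape `∀ p`), modulo the slot datum and
the harmonicity relations `hf` of `Φ₁`; the passage to `expP` itself is the (TWIST-2) item (route (a): `twistU21 = id`). -/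
theorem isPMinusKilledAlong_archKTypeOfLineZero_twist
    (hslot : ∃ ω₁ : Representation ℂ
        (Ginf (Fin 2) Unit
          (PosIdx (cmXW (L : Type) (frameD V) (lineVec (L : Type) (dW c.D 0)) (fun _ => dW_real c.D 0) ι₁ (cmPlace (L : Type) ι₁)))
          (NegIdx (cmXW (L : Type) (frameD V) (lineVec (L : Type) (dW c.D 0)) (fun _ => dW_real c.D 0) ι₁ (cmPlace (L : Type) ι₁))))
        (SchwartzMap (DPIdx (Fin 2) Unit
          (PosIdx (cmXW (L : Type) (frameD V) (lineVec (L : Type) (dW c.D 0)) (fun _ => dW_real c.D 0) ι₁ (cmPlace (L : Type) ι₁)))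
          (NegIdx (cmXW (L : Type) (frameD V) (lineVec (L : Type) (dW c.D 0)) (fun _ => dW_real c.D 0) ι₁ (cmPlace (L : Type) ι₁))) → ℝ)
          ℂ),
      IsArchWeilDatum (ι𝕎 (Fin 2) Unit _ _) ω₁ ∧ ∀ u, Continuous (ω₁ u))
    (hf : ∀ (p : Fin 2) (ℓ : Module.Dual ℂ (Fin 2 → ℂ)),
      hypOpGen (PosIdx (cmXW (L : Type) (frameD V) (lineVec (L : Type) (dW c.D 0)) (fun _ => dW_real c.D 0) ι₁ (cmPlace (L : Type) ι₁)))
          (NegIdx (cmXW (L : Type) (frameD V) (lineVec (L : Type) (dW c.D 0)) (fun _ => dW_real c.D 0) ι₁ (cmPlace (L : Type) ι₁))) p ()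
          (Φ₁ ℓ) +
        Complex.I • rotBoostGen
          (PosIdx (cmXW (L : Type) (frameD V) (lineVec (L : Type) (dW c.D 0)) (fun _ => dW_real c.D 0) ι₁ (cmPlace (L : Type) ι₁)))
          (NegIdx (cmXW (L : Type) (frameD V) (lineVec (L : Type) (dW c.D 0)) (fun _ => dW_real c.D 0) ι₁ (cmPlace (L : Type) ι₁))) p ()
          (Real.pi / 2) (Φ₁ ℓ) = 0) :
    ∀ p : Fin 2,
      (archKTypeOfLineZero hHD hI h₁ h₃ V c hGR hGR₀ hGR₁ hGR₂ hGR₃ η hη hηc h₁W A hV N Γ₀ hlevel Φ₁ Φ₂ ℓ₀ arch₀ harch hfin hsec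
          hK hΦ₁ hχ).IsPMinusKilledAlong (fun b => twistU21 L ι₁ (BallForms.expP b)) (-Complex.I • (Pi.single p 1 : Fin 2 → ℂ)) := by
  obtain ⟨ω₁, hW₁, hc₁⟩ := hslot
  rw [archKTypeOfLineZero_def]
  exact isPMinusKilledAlong_archKTypeOf_blockPair hHD hI h₁ h₃ _ hV 0 N Γ₀ Γ₀.K _ hlevel _ _ _ e₁ (frameD V) (frameD_real V)
    (frameD_ne V) (lineVec (L : Type) (dW c.D 0)) (fun _ => dW_real c.D 0) (fun _ => dW_ne c.D 0) hGR₀ (blockPosEquiv V)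
    (blockNegEquiv V) Φ₁ Φ₂ ℓ₀ arch₀ _ _ (frameD_sign_ι₁' V) (line_hs₁W h₁W 0) (frameD_sign_of_ne V)
    (fun τ hτ => line_hsW (dW c.D 0) τ hτ) hW₁ hc₁ (fun b => twistU21 L ι₁ (BallForms.expP b))
    (lineOmega_zero_twistU21_expP V c.D hGR hGR₀ hGR₁ (eta₀ V c.D η)) hf

end Zero

/-! ### line 1 -/

section One

variable
  (hlevel : ∀ δ ∈ levelImage hHD hI h₁ h₃ Γ₀ hV, ∃ x : (V.latticeModel printFact_unitaryCompact_holds).G,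
    x ∈ (satLevelRegimeOf V hV Γ₀.K : Subgroup (V.latticeModel printFact_unitaryCompact_holds).G) ∧
      (archSideOf V c hGR hGR₀ hGR₁ hGR₂ hGR₃ η hη hηc h₁W A).ιinf δ * x ∈ (V.latticeModel printFact_unitaryCompact_holds).Γ)
  (Φ₁ : Module.Dual ℂ (Fin 2 → ℂ) →ₗ[ℂ]
    SchwartzMap (DPIdx (Fin 2) Unit
      (PosIdx (cmXW (L : Type) (frameD V) (lineVec (L : Type) (dW c.D 1)) (fun _ => dW_real c.D 1) ι₁ (cmPlace (L : Type) ι₁)))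
      (NegIdx (cmXW (L : Type) (frameD V) (lineVec (L : Type) (dW c.D 1)) (fun _ => dW_real c.D 1) ι₁ (cmPlace (L : Type) ι₁))) → ℝ) ℂ)
  (Φ₂ : SchwartzMap ((Fin 3 × {v : {v : InfinitePlace ↥(maximalRealSubfield L) // v.IsReal} // v ≠ cmPlace (L : Type) ι₁}) → ℝ) ℂ)
  (ℓ₀ : Module.Dual ℂ (Fin 2 → ℂ))
  (arch₀ : blockFamilyOf (L : Type) e₁ (frameD V) (frameD_real V) (frameD_ne V) (lineVec (L : Type) (dW c.D 1))
      (fun _ => dW_real c.D 1) (fun _ => dW_ne c.D 1) ι₁ (blockPosEquiv V) (blockNegEquiv V) Φ₁ Φ₂ ℓ₀ = (A 1).Φinf)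
  (harch : ∀ a : UnitaryGroup.arch (↥(maximalRealSubfield L)) L (IsCMField.complexConj L) 3 V.Hm,
    UnitaryGroup.archAt (↥(maximalRealSubfield L)) L (IsCMField.complexConj L) 3 V.Hm (UnitaryGroup.cmPlace (L : Type) ι₁)
        (NumberField.complexConj_smul_infinitePlace (L : Type) _) (IsCMField.complexConj_ne_one (L : Type)) a = 1 →
    ∀ ℓ, ((archSideOf V c hGR hGR₀ hGR₁ hGR₂ hGR₃ η hη hηc h₁W A).P 1).ω
        (HodgeCM.Adelic.regimeEquiv L V.Hm hV
          (UnitaryGroup.archToAdelic (↥(maximalRealSubfield L)) L (IsCMField.complexConj L) 3 V.Hm a), 1)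
        (testFun (↥(maximalRealSubfield L)) (Fin 3)
          (blockFamilyOf (L : Type) e₁ (frameD V) (frameD_real V) (frameD_ne V) (lineVec (L : Type) (dW c.D 1))
            (fun _ => dW_real c.D 1) (fun _ => dW_ne c.D 1) ι₁ (blockPosEquiv V) (blockNegEquiv V) Φ₁ Φ₂ ℓ) (A 1).x₀ N) =
      testFun (↥(maximalRealSubfield L)) (Fin 3)
        (blockFamilyOf (L : Type) e₁ (frameD V) (frameD_real V) (frameD_ne V) (lineVec (L : Type) (dW c.D 1))
          (fun _ => dW_real c.D 1) (fun _ => dW_ne c.D 1) ι₁ (blockPosEquiv V) (blockNegEquiv V) Φ₁ Φ₂ ℓ) (A 1).x₀ N)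
  (hfin : ∀ kf : UnitaryGroup.finAdelic (↥(maximalRealSubfield L)) L (IsCMField.complexConj L) 3 V.Hm, kf ∈ Γ₀.K →
    ∀ Φinf : 𝓢((Fin 3 → mixedSpace (↥(maximalRealSubfield L))), ℂ),
      ((archSideOf V c hGR hGR₀ hGR₁ hGR₂ hGR₃ η hη hηc h₁W A).P 1).ω
          (HodgeCM.Adelic.regimeEquiv L V.Hm hV
            (UnitaryGroup.finAdelicToAdelic (↥(maximalRealSubfield L)) L (IsCMField.complexConj L) 3 V.Hm kf), 1)
          (testFun (↥(maximalRealSubfield L)) (Fin 3) Φinf (A 1).x₀ N) =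
        testFun (↥(maximalRealSubfield L)) (Fin 3) Φinf (A 1).x₀ N)
  (hsec : ∀ u : stabilizer U21 x₀,
    cmBlockSection (L : Type) (frameD V) (frameD_real V) (frameD_ne V) (lineVec (L : Type) (dW c.D 1)) (fun _ => dW_real c.D 1)
        (fun _ => dW_ne c.D 1) ι₁ (blockPosEquiv V) (blockNegEquiv V) (u21FrameEquiv (u : U21), 1) = (archSectionFrameOf V u, 1))
  {ev : VacExponents}
  (hK : ∀ (kk : DPK (Fin 2) Unit
      (PosIdx (cmXW (L : Type) (frameD V) (lineVec (L : Type) (dW c.D 1)) (fun _ => dW_real c.D 1) ι₁ (cmPlace (L : Type) ι₁)))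
      (NegIdx (cmXW (L : Type) (frameD V) (lineVec (L : Type) (dW c.D 1)) (fun _ => dW_real c.D 1) ι₁ (cmPlace (L : Type) ι₁))))
    (Φ : SchwartzMap (DPIdx (Fin 2) Unit
      (PosIdx (cmXW (L : Type) (frameD V) (lineVec (L : Type) (dW c.D 1)) (fun _ => dW_real c.D 1) ι₁ (cmPlace (L : Type) ι₁)))
      (NegIdx (cmXW (L : Type) (frameD V) (lineVec (L : Type) (dW c.D 1)) (fun _ => dW_real c.D 1) ι₁ (cmPlace (L : Type) ι₁))) → ℝ) ℂ),
    cmBlockRep (L : Type) e₁ (frameD V) (frameD_real V) (frameD_ne V) (lineVec (L : Type) (dW c.D 1)) (fun _ => dW_real c.D 1)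
        (fun _ => dW_ne c.D 1) hGR₁ ι₁ (blockPosEquiv V) (blockNegEquiv V)
        (cmBlockSection (L : Type) (frameD V) (frameD_real V) (frameD_ne V) (lineVec (L : Type) (dW c.D 1)) (fun _ => dW_real c.D 1)
          (fun _ => dW_ne c.D 1) ι₁ (blockPosEquiv V) (blockNegEquiv V) (κ _ _ _ _ kk)) (tensorPi Φ Φ₂) =
      tensorPi (κOp _ _ ev kk Φ) Φ₂)
  (hΦ₁ : ∀ (kV : Matrix.unitaryGroup (Fin 2) ℂ × Matrix.unitaryGroup Unit ℂ) (b : Fin 2 → ℂ),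
    unitaryOpPi (dualPairι ((kV, 1) : DPK (Fin 2) Unit
        (PosIdx (cmXW (L : Type) (frameD V) (lineVec (L : Type) (dW c.D 1)) (fun _ => dW_real c.D 1) ι₁ (cmPlace (L : Type) ι₁)))
        (NegIdx (cmXW (L : Type) (frameD V) (lineVec (L : Type) (dW c.D 1)) (fun _ => dW_real c.D 1) ι₁ (cmPlace (L : Type) ι₁)))))
        (Φ₁ (dotProductEquiv ℂ (Fin 2) b)) =
      Φ₁ (dotProductEquiv ℂ (Fin 2) ((kV.1 : Matrix (Fin 2) (Fin 2) ℂ) *ᵥ b)))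
  (hχ : ∀ u : stabilizer U21 x₀,
    ((lineScalar_one V c.D hGR hGR₀ hGR₁ (eta₁ V c.D η) (u : U21) : ℂˣ) : ℂ) *
        ((matA (stabilizerEquivK21.symm u)).det ^ ev.eP * sclD (stabilizerEquivK21.symm u) ^ ev.eQ) =
      star (sclD (stabilizerEquivK21.symm u)))

/-- **ROW 12 FOR LINE 1, ASSEMBLED AT THE HONEST S TERM.** -/
def archKTypeOfLineOne :
    ArchKTypeData (thetaSpaceInputIn hHD hI h₁ h₃ (archSideOf V c hGR hGR₀ hGR₁ hGR₂ hGR₃ η hη hηc h₁W A) hV) 1 N :=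
  archKTypeOf hHD hI h₁ h₃ (archSideOf V c hGR hGR₀ hGR₁ hGR₂ hGR₃ η hη hηc h₁W A) hV 1 N Γ₀ Γ₀.K
    (satLevelRegimeOf_le_archFinOf V hV Γ₀.K) hlevel (fun _ hg => hg)
    (lineOmega_one V c.D hGR hGR₀ hGR₁ (eta₁ V c.D η))
    (fun g => lineRepOf_one_archInfOf_eq V c.D hGR hGR₀ hGR₁ hGR₂ hGR₃ (eta₀ V c.D η) (eta₁ V c.D η) (eta₂ V c.D η)
      (eta₃ V c.D η) hV g)
    (blockFamilyOf (L : Type) e₁ (frameD V) (frameD_real V) (frameD_ne V) (lineVec (L : Type) (dW c.D 1)) (fun _ => dW_real c.D 1)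
      (fun _ => dW_ne c.D 1) ι₁ (blockPosEquiv V) (blockNegEquiv V) Φ₁ Φ₂)
    ℓ₀ arch₀
    (satLevel_fix_of_arch_of_fin (archSideOf V c hGR hGR₀ hGR₁ hGR₂ hGR₃ η hη hηc h₁W A) hV 1 N Γ₀.K
      (fun ℓ => blockFamilyOf (L : Type) e₁ (frameD V) (frameD_real V) (frameD_ne V) (lineVec (L : Type) (dW c.D 1))
        (fun _ => dW_real c.D 1) (fun _ => dW_ne c.D 1) ι₁ (blockPosEquiv V) (blockNegEquiv V) Φ₁ Φ₂ ℓ) harch hfin)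
    (lineOmega_one_harm V c.D hGR hGR₀ hGR₁ (eta₁ V c.D η) Φ₁ Φ₂ hsec hK hΦ₁ hχ)


-- port_pkg: scope closed for this part
end One
end Line
end HodgeCM.Model
end
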